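import Literature.MathematicalPhysics.QuantumFieldTheory.Balaban1983to89.B9SectBCodedClassGY
import Literature.MathematicalPhysics.QuantumFieldTheory.Balaban1983to89.B9B8AveragingJunction

/-!
# `Balaban1983to89.B9SectBCodedClassKnitY` — THE CODED CLASS (3.37) OF THE SECT.-B CHAIN AT THE KNIT TRANSPORTER `parKnitY`:
# (3.58)∕(3.59) for a GENERIC site transporter from ONE displayed transporter-variation law, the knit coded class `C37KY`, and its `hclass`

T. Bałaban, *Propagators for lattice gauge theories in a background field*, Commun. Math. Phys. **99** (1985) 389–434
[`Balaban1985BackgroundPropagators`, "B9"]; [5] = T. Bałaban, *Averaging operations for lattice gauge theories*, Commun. Math. Phys. **98** (1985) 17–51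
[`Balaban1985Averaging`]; [4] = T. Bałaban, *Propagators and renormalization transformations for lattice gauge theories. II*, Commun. Math. Phys. **96**
(1984) 223–250 [`Balaban1984PropagatorsII`].

statement-level skeleton of published theorems with citation tags; proofs where landed; nothing here is a claim about the
Yang–Mills mass gap

THE PRINTED LOCUS.  p. 401 (after (3.56)): *«… by the above bounds |(U′U)(Γ^{(j)}_{y,x})(U(Γ^{(j)}_{y,x}))⁻¹ − 1| < O(1)α₁.»*  (3.57) p. 401, (3.58)–(3.59) p. 402:
*«(Q′_j(U′U)λ)(y) = (Q′_j(U)λ)(y) + (F′_{2,j}(A)λ)(y), … |F′_{2,j}(A; y, x)| ≤ O(1)α₁, (3.58) hence also |(F′_{2,j}(A)λ)(y)| ≤ O(1)α₁(Q′_j|λ|)(y). (3.59)»*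
p. 393 ((3.19)): the contours `Γ^{(j)}_{y,x}` of print's averaging are the COMPOSITE contours *«defined by (52), (53) in [5]»* — NODE 00's KNIT transporter
`B9B8AveragingJunction.parKnitY` (legs `U(Γ^{(j)}_{y,w})`, inverse legs, `1` at the pairs the letters never read).  (3.37) p. 396: the class of the pair `(U, U′)`.

WHY THIS FILE (pub-ymgap N06, CASCADE-K «K2-G-C37K», seat dag-n06-c g26; node00-def-Y's scoping + supplier spec I.20622 (K2)∕(K3); dag-n06-l holds (K1)).
The Sect.-B junction over a generic averaging pair (`B9SectBStepUParGQOfMembers.sectBStepUParGQ_parSymYH_of_members`, this seat g25) displays, among its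
laws, `hC37 : ∀ j β U a, C37 j β U a → GVal U ∧ CplxLettersY G (f j) (parA j) (ιB j) Cq β U a` and `hparC : … → ∀ z w, parA j U z w ∈ G`.  The tree's
coded classes `C37Y` (g8) ∕ `C37GY` (g13) read the variation letters (3.58)∕(3.59) at the STRAIGHT (taxicab) transporter `parSymY` and carry NO (3.35)
datum on the base; at the knit certificate's `parA := parKnitY` ([5]'s composite contours) the variation (3.58) is [5]-Prop.-7 analysis that exists only
over (3.35)-regular bases — so neither class can serve.  THIS FILE supplies everything of the knit class EXCEPT that analysis, which enters as ONE displayed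
law (`ParVar337Y`, dag-n06-l's (K1) `norm_parKnitY_cplxMul_sub_le`):
* §1 (any `𝔸`, any transporter table) the elementary packaging behind (3.58)∕(3.59): two units `q, q′` with `‖q‖, ‖q⁻¹‖ ≦ 1` and `‖q′ − q‖ ≦ D ≦ 1∕2` have
  `‖q′⁻¹‖ ≦ 2`, `‖q′⁻¹ − q⁻¹‖ ≦ 2D` and `‖R(q′) − R(q)‖, ‖R(q′⁻¹) − R(q⁻¹)‖ ≦ 4D` (`norm_inv_bounds_of_close`, `norm_Rclm_sub_le_of_close`); hence for ANY
  inverse-symmetric site transporter `par` whose table at `U` is `G`-valued at the corner pairs and whose CORNER-PAIR VARIATION under the multiplier is `≦ D`: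
  `‖kF(s, w)‖ ≦ 4D·W_s⁻¹` (`norm_kFY_le_of_parVar`) and `‖sF(z)‖ ≦ 4D` (`norm_sFY_le_of_parVar`); ★★ `cplxLettersY_of_cplx337_par` — g8's
  `cplxLettersY_of_cplx337` with `parSymY` replaced by any such `par` (clauses 3–7 are transporter-free and are TAKEN from the landed theorem).
* §2 the two displayed laws of a transporter table: `ParVar337Y` ((3.58)'s key estimate at the corner pairs over regular bases, p. 401) and `ParMemY`
  («the table is `G`-valued over regular bases», the junction's guarded `hparG` shape; at `parKnitY` = dag-n06-l's `B9Eq3124HZKnitPairReg335YMemG.parKnitY_mem_of_reg335P`).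
* §3 ★★ THE KNIT CODED CLASS `C37KY := C37GY ∧ CplxLettersY (parKnitY) ∧ «parKnitY U is G-valued» ∧ «(3.35) datum of U» ∧ «raw (3.37) datum of a» ∧ β ≦ β₀`
  and its projections — the junction's `hC37 ∕ hparC ∕ hC37G ∕ hvarB` VERBATIM at `parA := parKnitY` (`hC37_of_C37KY`, `hparC_of_C37KY`, `hC37G_of_C37KY`,
  `hvarB_of_C37KY`), the (3.35) datum (`regDatum_of_C37KY`), the raw (3.37) datum (`cplx337_of_C37KY`), the exponent window (`le_of_C37KY`).
* §4 ★★ `hclass_C37KY_at` ∕ `hclass_C37KY_on`: GIVEN the two laws at `parKnitY`, every `U′` of the record's class (3.37) at exponent `0 < α₁` (below the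
  caps) over a (3.35)-REGULAR base above the thresholds has its code `a := A′` in `C37KY` at `L⁴α₁` (`hclass_C37GY_at`'s shape with the regularity guards).

HONEST SCOPE.  Letters bookkeeping plus one elementary normed-ring estimate; the knit (3.58) itself ([5] Prop. 7 analysis) is NOT proved here — it is
the displayed law `ParVar337Y … (parKnitY _) …`, every theorem needing it takes it as a hypothesis; the class `C37KY` is a DEFINITION (a conjunction of
typed readings), shown inhabited only relative to the two laws (§4); nothing of Thm 3.1 ∕ Thm 3.4 asserted; COUNT-NEUTRAL; N06 NOT discharged; one finite
lattice programme — nothing continuum ∕ OS ∕ mass-gap ∕ Clay.  Cell `pub-ymgap` (HUMAN RULING D-0062), Track A node N06 [B9], 2026-08-30.  NEW file;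
nothing landed is modified.

RELATED IN THE TREE, NOT DUPLICATED: `B9SectBCodedClassY` (`C37Y`, `cplxLettersY_of_cplx337`, `hclass_C37Y_at`), `B9SectBCodedClassGY` (`C37GY`,
`hclass_C37GY_at`), `B9Eq358TaxiLettersY` (`norm_Rclm_sub_le`, the straight-transporter estimates `norm_kFY_parSymY_le` ∕ `norm_sFY_parSymY_le`),
`B9B8AveragingJunction` (`parKnitY`, `parKnitY_inv`), `B9Eq3124HZKnitPairReg335YMemG` (`parKnitY_mem_of_reg335P` — the supplier of `ParMemY` at the knit),
`B9SectBGpFrameCodedY` (`CplxLettersY`), `B9SectBStepUParGQOfMembers` (the consumer's binders).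
-/

noncomputable section

namespace Literature.MathematicalPhysics.QuantumFieldTheory.Balaban1983to89.B9SectBCodedClassKnitY

open Complex
open T4RelativeLadder (UnitaryLike)
open B6Geom246MultiLevelBox (blkOf)
open B6GlobalChartV1 (PV)
open B6KLevelCensusIndexV1 (KIdx kGeo)
open B6Ineq2142KLevelV1 (β)
open B9BackgroundsKLevelV1 (shiftsV1 levV1)
open B9Eq39Adjoint (fluct)
open B9Eq335RegularityClasses (Cplx337)
open B9Eq360DeltaPrimeAY (Rclm kQY sQY kFY sFY mulY AfldY blkY blkY_apply)
open B9Thm311ReadingAtLetters (wB wB_pos)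
open B9PinMembersKLevelV1 (MemberY geo9Y bg9Y)
open B9SectBGpLettersY (GVal kFC sFC wC blkC norm_le_one_and_inv_of_mem)
open B9SectBGpFrameCodedY (codingYx CplxLettersY)
open B9SectBCodedClassY (cplxLettersY_of_cplx337)
open B9SectBCodedClassGY (C37GY cplxLettersGY_of_cplx337)
open B9SectBGClassLettersY (CplxLettersGY VarParBY)
open B9Eq359VarParBY (cVarGY cVarGY_nonneg varParBY_mono varParBY_parBY_of_cplx337)
open B9Eq358TaxiLettersY (norm_Rclm_sub_le)
open B9B8AveragingJunction (parKnitY parKnitY_inv)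
open Node00 (SiteY BlkY IBondY CfgY SiteParY blkCornerY parBY)

variable {𝔸 : Type} [NormedRing 𝔸] [NormedAlgebra ℂ 𝔸] [CompleteSpace 𝔸]
variable {d ℓ : ℕ} {hd : 1 ≤ d + 1} {hL : Odd (ℓ + 1) ∧ 1 < ℓ + 1} {b₀ b₁ : ℝ}

/-! ## §1 The elementary packaging behind (3.58)∕(3.59) for a generic transporter table -/

section Close

omit [NormedAlgebra ℂ 𝔸] [CompleteSpace 𝔸] in
/-- **TWO CLOSE UNITS, THE FIRST UNITARY-LIKE**: `‖q‖, ‖q⁻¹‖ ≦ 1`, `‖q′ − q‖ ≦ D ≦ 1∕2` give `‖q′‖ ≦ 1 + D`, `‖q′⁻¹‖ ≦ 2` and `‖q′⁻¹ − q⁻¹‖ ≦ 2D`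
(`q′⁻¹ − q⁻¹ = q′⁻¹(q − q′)q⁻¹`; no Neumann series — `q′` is a unit). [cite: Balaban1985BackgroundPropagators, p.401 («|(U′U)(Γ)(U(Γ))⁻¹ − 1| < O(1)α₁»), (3.3) p.391] -/
theorem norm_inv_bounds_of_close (q' q : 𝔸ˣ) (hq : ‖(q : 𝔸)‖ ≤ 1) (hqi : ‖((q⁻¹ : 𝔸ˣ) : 𝔸)‖ ≤ 1) {D : ℝ} (hD0 : 0 ≤ D) (hD : D ≤ 1 / 2)
    (h : ‖(q' : 𝔸) - (q : 𝔸)‖ ≤ D) :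
    ‖(q' : 𝔸)‖ ≤ 1 + D ∧ ‖((q'⁻¹ : 𝔸ˣ) : 𝔸)‖ ≤ 2 ∧ ‖((q'⁻¹ : 𝔸ˣ) : 𝔸) - ((q⁻¹ : 𝔸ˣ) : 𝔸)‖ ≤ 2 * D := by
  have h1 : ‖(q' : 𝔸)‖ ≤ 1 + D := by
    have := norm_le_norm_add_norm_sub' (q' : 𝔸) (q : 𝔸)
    linarith
  -- the resolvent identity for units
  have hid : ((q'⁻¹ : 𝔸ˣ) : 𝔸) - ((q⁻¹ : 𝔸ˣ) : 𝔸) = ((q'⁻¹ : 𝔸ˣ) : 𝔸) * ((q : 𝔸) - (q' : 𝔸)) * ((q⁻¹ : 𝔸ˣ) : 𝔸) := by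
    rw [mul_sub, sub_mul, Units.mul_inv_cancel_right, Units.inv_mul, one_mul]
  have hdiff : ‖((q'⁻¹ : 𝔸ˣ) : 𝔸) - ((q⁻¹ : 𝔸ˣ) : 𝔸)‖ ≤ ‖((q'⁻¹ : 𝔸ˣ) : 𝔸)‖ * D := by
    rw [hid]
    calc ‖((q'⁻¹ : 𝔸ˣ) : 𝔸) * ((q : 𝔸) - (q' : 𝔸)) * ((q⁻¹ : 𝔸ˣ) : 𝔸)‖
        ≤ ‖((q'⁻¹ : 𝔸ˣ) : 𝔸)‖ * ‖(q : 𝔸) - (q' : 𝔸)‖ * ‖((q⁻¹ : 𝔸ˣ) : 𝔸)‖ :=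
          (norm_mul_le _ _).trans (mul_le_mul_of_nonneg_right (norm_mul_le _ _) (norm_nonneg _))
      _ ≤ ‖((q'⁻¹ : 𝔸ˣ) : 𝔸)‖ * D * 1 := by
          gcongr
          · rw [norm_sub_rev]; exact h
      _ = _ := by ring
  -- `‖q′⁻¹‖ ≤ ‖q⁻¹‖ + ‖q′⁻¹‖·D` hence `‖q′⁻¹‖(1 − D) ≤ 1`
  have h2 : ‖((q'⁻¹ : 𝔸ˣ) : 𝔸)‖ ≤ 2 := by
    have hle : ‖((q'⁻¹ : 𝔸ˣ) : 𝔸)‖ ≤ ‖((q⁻¹ : 𝔸ˣ) : 𝔸)‖ + ‖((q'⁻¹ : 𝔸ˣ) : 𝔸) - ((q⁻¹ : 𝔸ˣ) : 𝔸)‖ :=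
      norm_le_norm_add_norm_sub' _ _
    have hn : 0 ≤ ‖((q'⁻¹ : 𝔸ˣ) : 𝔸)‖ := norm_nonneg _
    nlinarith
  refine ⟨h1, h2, hdiff.trans ?_⟩
  nlinarith [norm_nonneg (((q'⁻¹ : 𝔸ˣ) : 𝔸))]

omit [CompleteSpace 𝔸] in
/-- ★ **THE ADJOINT ACTIONS OF TWO CLOSE UNITS**: under the hypotheses of `norm_inv_bounds_of_close`, `‖R(q′) − R(q)‖ ≦ 4D` and `‖R(q′⁻¹) − R(q⁻¹)‖ ≦ 4D`
(`norm_Rclm_sub_le` with the bounds above; `2D² ≦ D`). [cite: Balaban1985BackgroundPropagators, (3.57)–(3.58) pp.401–402, (3.1) p.390] -/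
theorem norm_Rclm_sub_le_of_close (q' q : 𝔸ˣ) (hq : ‖(q : 𝔸)‖ ≤ 1) (hqi : ‖((q⁻¹ : 𝔸ˣ) : 𝔸)‖ ≤ 1) {D : ℝ} (hD0 : 0 ≤ D) (hD : D ≤ 1 / 2)
    (h : ‖(q' : 𝔸) - (q : 𝔸)‖ ≤ D) :
    ‖Rclm q' - Rclm q‖ ≤ 4 * D ∧ ‖Rclm q'⁻¹ - Rclm q⁻¹‖ ≤ 4 * D := by
  obtain ⟨h1, h2, h3⟩ := norm_inv_bounds_of_close q' q hq hqi hD0 hD h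
  have hDD : 2 * D * D ≤ D := by nlinarith
  refine ⟨(norm_Rclm_sub_le q' q).trans ?_, (norm_Rclm_sub_le q'⁻¹ q⁻¹).trans ?_⟩
  · calc ‖(q' : 𝔸) - (q : 𝔸)‖ * ‖((q'⁻¹ : 𝔸ˣ) : 𝔸)‖ + ‖(q : 𝔸)‖ * ‖((q'⁻¹ : 𝔸ˣ) : 𝔸) - ((q⁻¹ : 𝔸ˣ) : 𝔸)‖
        ≤ D * 2 + 1 * (2 * D) := by gcongr
      _ = 4 * D := by ring
  · rw [inv_inv, inv_inv]
    calc ‖((q'⁻¹ : 𝔸ˣ) : 𝔸) - ((q⁻¹ : 𝔸ˣ) : 𝔸)‖ * ‖(q' : 𝔸)‖ + ‖((q⁻¹ : 𝔸ˣ) : 𝔸)‖ * ‖(q' : 𝔸) - (q : 𝔸)‖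
        ≤ (2 * D) * (1 + D) + 1 * D := by gcongr
      _ = 3 * D + 2 * D * D := by ring
      _ ≤ 4 * D := by linarith

end Close

section Letters

variable (i : KIdx d ℓ hd hL b₀ b₁) (par : SiteParY 𝔸 i)

/-- ★ **(3.58) FOR A GENERIC TRANSPORTER TABLE**: if `par` is inverse-symmetric, its value at the corner pair `(c_s, w)` of `U` is unitary-like, and the
corner-pair variation under `U ↦ U′U` is `≦ D ≦ 1∕2`, then `‖kF(s, w)‖ = ‖kQ_{U′U}(s, w) − kQ_U(s, w)‖ ≦ 4D·W_s⁻¹`.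
[cite: Balaban1985BackgroundPropagators, (3.58) p.402, (3.19) p.393, p.401] -/
theorem norm_kFY_le_of_parVar {U U' : CfgY 𝔸 i} (s : BlkY i) (w : SiteY i)
    (hq : ‖(par U (blkCornerY i s) w : 𝔸)‖ ≤ 1) (hqi : ‖(((par U (blkCornerY i s) w)⁻¹ : 𝔸ˣ) : 𝔸)‖ ≤ 1)
    {D : ℝ} (hD0 : 0 ≤ D) (hD : D ≤ 1 / 2) (hvar : ‖(par U' (blkCornerY i s) w : 𝔸) - (par U (blkCornerY i s) w : 𝔸)‖ ≤ D) :
    ‖kFY i par U U' s w‖ ≤ 4 * D * (wB i s)⁻¹ := by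
  have hwB : 0 < wB i s := wB_pos i s
  have hval : kFY i par U U' s w = (wB i s)⁻¹ • (Rclm (par U' (blkCornerY i s) w) - Rclm (par U (blkCornerY i s) w)) := by
    simp only [kFY, kQY, smul_sub]
  rw [hval, norm_smul, Real.norm_eq_abs, abs_of_pos (inv_pos.2 hwB), mul_comm]
  exact mul_le_mul_of_nonneg_right (norm_Rclm_sub_le_of_close _ _ hq hqi hD0 hD hvar).1 (inv_nonneg.2 hwB.le)

/-- ★ **(3.59)-SHAPE FOR A GENERIC TRANSPORTER TABLE**: with `par` inverse-symmetric (`par V z c = (par V c z)⁻¹`), the same corner-pair hypotheses at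
`(c_{s(z)}, z)` give `‖sF(z)‖ = ‖sQ_{U′U}(z) − sQ_U(z)‖ ≦ 4D` (the letter reads the reverse pair, i.e. the inverses).
[cite: Balaban1985BackgroundPropagators, (3.59) p.402, (3.24) p.394, p.401] -/
theorem norm_sFY_le_of_parVar (hsym : ∀ (V : CfgY 𝔸 i) (z z' : SiteY i), par V z z' = (par V z' z)⁻¹) {U U' : CfgY 𝔸 i} (z : SiteY i)
    (hq : ‖(par U (blkCornerY i (blkY i z)) z : 𝔸)‖ ≤ 1) (hqi : ‖(((par U (blkCornerY i (blkY i z)) z)⁻¹ : 𝔸ˣ) : 𝔸)‖ ≤ 1)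
    {D : ℝ} (hD0 : 0 ≤ D) (hD : D ≤ 1 / 2)
    (hvar : ‖(par U' (blkCornerY i (blkY i z)) z : 𝔸) - (par U (blkCornerY i (blkY i z)) z : 𝔸)‖ ≤ D) :
    ‖sFY i par U U' z‖ ≤ 4 * D := by
  have hval : sFY i par U U' z = Rclm (par U' (blkCornerY i (blkY i z)) z)⁻¹ - Rclm (par U (blkCornerY i (blkY i z)) z)⁻¹ := by
    simp only [sFY, sQY]
    rw [hsym U' z, hsym U z]
  rw [hval]
  exact (norm_Rclm_sub_le_of_close _ _ hq hqi hD0 hD hvar).2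

end Letters

/-! ## §1b ★★ The seven letters of (3.37) at a generic transporter -/

section Generic

variable [NormOneClass 𝔸] {Mstar : ℕ} (G : Subgroup 𝔸ˣ) (x : MemberY d ℓ hd hL b₀ b₁ Mstar) (par : SiteParY 𝔸 x.toKIdx)
  (ιB : BlkY x.toKIdx → IBondY x.toKIdx)

/-- ★★ **THE CODED CLASS LETTERS FROM (3.37) AT A GENERIC TRANSPORTER**: at a `G`-valued `U` (unit-norm `G`), for `a` in r06's class `Cplx337` on the member's
torus chart at exponent `0 < α₁ ≦ 1∕4`, above `2(d+1) < M`, and for an inverse-symmetric transporter table `par` whose values at the corner pairs of `U` lie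
in `G` and whose corner-pair variation under `U ↦ e^{iηa}U` is `≦ C_p·α₁ ≦ 1∕2`: the seven bounds of `CplxLettersY G x par ιB (4C_p) (L⁴α₁) U a` hold —
clauses 1–2 ((3.58)∕(3.59)) by §1, clauses 3–7 (transporter-free) from `B9SectBCodedClassY.cplxLettersY_of_cplx337`.
[cite: Balaban1985BackgroundPropagators, (3.37) p.396, p.397, (3.58)–(3.59) p.402, p.401] -/
theorem cplxLettersY_of_cplx337_par (hι : ∀ s : BlkY x.toKIdx, β x.toKIdx.hN x.toKIdx.D x.toKIdx.hk (ιB s) = s)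
    (hG1 : ∀ u : 𝔸ˣ, u ∈ G → ‖(u : 𝔸)‖ ≤ 1) (hdM : 2 * ((d : ℝ) + 1) < (geo9Y x).M)
    {U : CfgY 𝔸 x.toKIdx} (hU : GVal G x.toKIdx U) {α₁ : ℝ} (hα₁ : 0 < α₁) (hα₁4 : α₁ ≤ 1 / 4) {a : AfldY 𝔸 x.toKIdx}
    (h : Cplx337 (shiftsV1 (PV d ℓ x.m x.K hd hL)) U (kGeo x.toKIdx).eta (kGeo x.toKIdx).L (levV1 x.toKIdx) α₁ a)
    (hsym : ∀ (V : CfgY 𝔸 x.toKIdx) (z z' : SiteY x.toKIdx), par V z z' = (par V z' z)⁻¹)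
    (hmem : ∀ w : SiteY x.toKIdx, par U (blkCornerY x.toKIdx (blkY x.toKIdx w)) w ∈ G)
    {Cp : ℝ} (hCp : 0 ≤ Cp) (hCpα : Cp * α₁ ≤ 1 / 2)
    (hvar : ∀ w : SiteY x.toKIdx,
      ‖(par (mulY x.toKIdx (fluct (kGeo x.toKIdx).eta a) U) (blkCornerY x.toKIdx (blkY x.toKIdx w)) w : 𝔸) -
          (par U (blkCornerY x.toKIdx (blkY x.toKIdx w)) w : 𝔸)‖ ≤ Cp * α₁) :
    CplxLettersY G x par ιB (4 * Cp) ((((ℓ : ℝ) + 1) ^ 4) * α₁) U a := by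
  obtain ⟨-, -, h3, h4, h5, h6, h7⟩ := cplxLettersY_of_cplx337 G x ιB hι hG1 hdM hU hα₁ hα₁4 h
  have hL4 : (1 : ℝ) ≤ ((ℓ : ℝ) + 1) ^ 4 := one_le_pow₀ (by have : (0 : ℝ) ≤ ℓ := Nat.cast_nonneg _; linarith)
  have hD0 : 0 ≤ Cp * α₁ := mul_nonneg hCp hα₁.le
  -- the block of `z` in terms of the label `y` (the section `hι`)
  have hs : ∀ (y : IBondY x.toKIdx) (z : SiteY x.toKIdx), blkC x.toKIdx ιB z = y → blkY x.toKIdx z = β x.toKIdx.hN x.toKIdx.D x.toKIdx.hk y := by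
    intro y z hzy
    have : β x.toKIdx.hN x.toKIdx.D x.toKIdx.hk (blkC x.toKIdx ιB z) = blkY x.toKIdx z := by rw [blkC, hι]
    rw [hzy] at this; exact this.symm
  refine ⟨?_, ?_, h3, h4, h5, h6, h7⟩
  · -- (1) the kernel variation letter `kF` ((3.58))
    intro y z hzy
    have hzs := hs y z hzy
    obtain ⟨hq, hqi⟩ := norm_le_one_and_inv_of_mem G hG1 (hmem z)
    rw [hzs] at hq hqi
    have hv := hvar z
    rw [hzs] at hv
    have hk := norm_kFY_le_of_parVar x.toKIdx par (β x.toKIdx.hN x.toKIdx.D x.toKIdx.hk y) z hq hqi hD0 hCpα hv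
    have hwB : 0 < wB x.toKIdx (β x.toKIdx.hN x.toKIdx.D x.toKIdx.hk y) := wB_pos x.toKIdx _
    show ‖kFY x.toKIdx par U (mulY x.toKIdx (fluct (kGeo x.toKIdx).eta a) U) (β x.toKIdx.hN x.toKIdx.D x.toKIdx.hk y) z‖
      ≤ 4 * Cp * (((ℓ : ℝ) + 1) ^ 4 * α₁) * (wB x.toKIdx (β x.toKIdx.hN x.toKIdx.D x.toKIdx.hk y))⁻¹
    refine hk.trans ?_
    have h0 : 0 ≤ 4 * Cp * α₁ * (wB x.toKIdx (β x.toKIdx.hN x.toKIdx.D x.toKIdx.hk y))⁻¹ := by positivity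
    calc 4 * (Cp * α₁) * (wB x.toKIdx (β x.toKIdx.hN x.toKIdx.D x.toKIdx.hk y))⁻¹
        = (4 * Cp * α₁ * (wB x.toKIdx (β x.toKIdx.hN x.toKIdx.D x.toKIdx.hk y))⁻¹) * 1 := by ring
      _ ≤ (4 * Cp * α₁ * (wB x.toKIdx (β x.toKIdx.hN x.toKIdx.D x.toKIdx.hk y))⁻¹) * ((ℓ : ℝ) + 1) ^ 4 :=
          mul_le_mul_of_nonneg_left hL4 h0
      _ = _ := by ring
  · -- (2) the starred variation letter `sF` ((3.59))
    intro z
    obtain ⟨hq, hqi⟩ := norm_le_one_and_inv_of_mem G hG1 (hmem z)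
    have hsF := norm_sFY_le_of_parVar x.toKIdx par hsym z hq hqi hD0 hCpα (hvar z)
    show ‖sFY x.toKIdx par U (mulY x.toKIdx (fluct (kGeo x.toKIdx).eta a) U) z‖ ≤ 4 * Cp * (((ℓ : ℝ) + 1) ^ 4 * α₁)
    refine hsF.trans ?_
    have h0 : 0 ≤ 4 * Cp * α₁ := by positivity
    calc 4 * (Cp * α₁) = (4 * Cp * α₁) * 1 := by ring
      _ ≤ (4 * Cp * α₁) * ((ℓ : ℝ) + 1) ^ 4 := mul_le_mul_of_nonneg_left hL4 h0
      _ = _ := by ring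

end Generic

/-! ## §2 The two displayed laws of a transporter table -/

section Laws

variable (G : Subgroup 𝔸ˣ) (i : KIdx d ℓ hd hL b₀ b₁) (par : SiteParY 𝔸 i) (R : ℝ → CfgY 𝔸 i → Prop)

/-- **THE TRANSPORTER-VARIATION LAW (3.58)'s KEY ESTIMATE, DISPLAYED** for a transporter table `par`, a regularity predicate `R` (the instance's (3.35):
`(bg9KP 𝔸 G i).Reg335 c₀` for the knit supplier), constant `C_p`, exponent cap `α_K`, threshold `a_K`: over every `G`-valued base `U` with `R α₀ U`,
`0 < α₀`, `M·α₀ ≦ a_K`, and every field `a` of r06's class (3.37) at `0 < α₁ ≦ α_K`, the corner-pair variation of the table under `U ↦ e^{iηa}U` is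
`≦ C_p·α₁`: `‖par(e^{iηa}U)(c_{s(w)}, w) − par(U)(c_{s(w)}, w)‖ ≦ C_p·α₁` for every site `w`.  At `par := parKnitY` this is the knit (3.58) estimate of
p. 401 for [5]'s composite contours (dag-n06-l's `norm_parKnitY_cplxMul_sub_le`); at `parSymY` it is `B9Eq358TaxiLettersY.norm_parTaxiV_prod_sub_le`.
[cite: Balaban1985BackgroundPropagators, p.401 («|(U′U)(Γ^{(j)}_{y,x})(U(Γ^{(j)}_{y,x}))⁻¹ − 1| < O(1)α₁»), (3.37) p.396, (3.35) p.396; Balaban1985Averaging, Prop. 7 p.43] -/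
def ParVar337Y (Cp αK aK : ℝ) : Prop :=
  ∀ (α₀ : ℝ) (U : CfgY 𝔸 i), 0 < α₀ → (kGeo i).M * α₀ ≤ aK → R α₀ U → GVal G i U →
    ∀ (α₁ : ℝ) (a : AfldY 𝔸 i), 0 < α₁ → α₁ ≤ αK →
      Cplx337 (shiftsV1 (PV d ℓ i.m i.K hd hL)) U (kGeo i).eta (kGeo i).L (levV1 i) α₁ a →
      ∀ w : SiteY i,
        ‖(par (mulY i (fluct (kGeo i).eta a) U) (blkCornerY i (blkY i w)) w : 𝔸) - (par U (blkCornerY i (blkY i w)) w : 𝔸)‖ ≤ Cp * α₁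

/-- **THE MEMBERSHIP LAW, DISPLAYED**: over every base `U` with `R α₀ U`, `0 < α₀`, `M·α₀ ≦ a_K`, the whole table `par U` is `G`-valued (the junction's guarded
`hparG` shape at one index; at `parKnitY` = `B9Eq3124HZKnitPairReg335YMemG.parKnitY_mem_of_reg335P`).
[cite: Balaban1985BackgroundPropagators, (3.19) p.393, (3.35) p.396; Balaban1985Averaging, Prop. 2 p.26] -/
def ParMemY (aK : ℝ) : Prop :=
  ∀ (α₀ : ℝ) (U : CfgY 𝔸 i), 0 < α₀ → (kGeo i).M * α₀ ≤ aK → R α₀ U → ∀ z w : SiteY i, par U z w ∈ G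

end Laws

/-! ## §3 ★★ The knit coded class `C37KY` and its projections -/

section Class

variable [NormOneClass 𝔸] {Mstar : ℕ} (G : Subgroup 𝔸ˣ) (x : MemberY d ℓ hd hL b₀ b₁ Mstar) (ιB : BlkY x.toKIdx → IBondY x.toKIdx)
  (R : ℝ → CfgY 𝔸 x.toKIdx → Prop)

/-- ★★ **THE KNIT CODED CLASS (3.37) OF THE SECT.-B CHAIN AT NODE 00**: a pair (base `U`, field `a`) is in the class at exponent `β` iff
(i) it is in g13's extended class `C37GY` at `β` (constant `Cq`; the straight-transporter letters, the G-clause letters, the bond transporter variation);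
(ii) the seven root letters `CplxLettersY` hold at `β` AT THE KNIT TRANSPORTER `parKnitY` (constant `CqK`);
(iii) the knit table `parKnitY U` is `G`-valued;
(iv) «`U` is (3.35)-regular above the thresholds»: `∃ α₀, 0 < α₀ ∧ M_K ≦ M ∧ M·α₀ ≦ a_K ∧ R α₀ U` for the instance's regularity predicate `R`;
(v) the raw printed datum: `β = L⁴α₁` for some `0 < α₁ ≦ 1∕4` with `a` in r06's class `Cplx337` at `α₁`;
(vi) the exponent window `β ≦ β₀`.
Every law the knit junction consumes is a projection (below); the class is shown inhabited relative to the two displayed laws in §4.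
[cite: Balaban1985BackgroundPropagators, (3.37) p.396, (3.35) p.396, (3.58)–(3.59) p.402, (3.19) p.393] -/
def C37KY (Cq CqK MK aK β₀ : ℝ) : ℝ → CfgY 𝔸 x.toKIdx → AfldY 𝔸 x.toKIdx → Prop :=
  fun β' U a => C37GY G x ιB Cq β' U a ∧ CplxLettersY G x (parKnitY x.toKIdx) ιB CqK β' U a ∧
    (∀ z w : SiteY x.toKIdx, parKnitY x.toKIdx U z w ∈ G) ∧
    (∃ α₀ : ℝ, 0 < α₀ ∧ MK ≤ (geo9Y x).M ∧ (geo9Y x).M * α₀ ≤ aK ∧ R α₀ U) ∧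
    (∃ α₁ : ℝ, 0 < α₁ ∧ α₁ ≤ 1 / 4 ∧ β' = (((ℓ : ℝ) + 1) ^ 4) * α₁ ∧
      Cplx337 (shiftsV1 (PV d ℓ x.m x.K hd hL)) U (kGeo x.toKIdx).eta (kGeo x.toKIdx).L (levV1 x.toKIdx) α₁ a) ∧
    β' ≤ β₀

variable {Cq CqK MK aK β₀ : ℝ}

omit [NormOneClass 𝔸] in
/-- the knit class refines g13's extended class `C37GY`. [cite: Balaban1985BackgroundPropagators, (3.37) p.396, bookkeeping] -/
theorem c37GY_of_C37KY {β' : ℝ} {U : CfgY 𝔸 x.toKIdx} {a : AfldY 𝔸 x.toKIdx} (h : C37KY G x ιB R Cq CqK MK aK β₀ β' U a) :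
    C37GY G x ιB Cq β' U a := h.1

omit [NormOneClass 𝔸] in
/-- the knit class implies «`U` is `G`-valued». [cite: Balaban1985BackgroundPropagators, (3.35) p.396, bookkeeping] -/
theorem gVal_of_C37KY {β' : ℝ} {U : CfgY 𝔸 x.toKIdx} {a : AfldY 𝔸 x.toKIdx} (h : C37KY G x ιB R Cq CqK MK aK β₀ β' U a) :
    GVal G x.toKIdx U := h.1.1.1

omit [NormOneClass 𝔸] in
/-- ★ **THE JUNCTION's `hC37` AT `parA := parKnitY` HOLDS BY PROJECTION** for `C37 := C37KY` (the binder `hC37` of `B9SectBStepUParGQOfMembers`, constant `CqK`).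
[cite: Balaban1985BackgroundPropagators, (3.37) p.396, (3.58)–(3.59) p.402, bookkeeping] -/
theorem hC37_of_C37KY :
    ∀ β' (U : CfgY 𝔸 x.toKIdx) (a : AfldY 𝔸 x.toKIdx), C37KY G x ιB R Cq CqK MK aK β₀ β' U a →
      GVal G x.toKIdx U ∧ CplxLettersY G x (parKnitY x.toKIdx) ιB CqK β' U a :=
  fun _ _ _ h => ⟨h.1.1.1, h.2.1⟩

omit [NormOneClass 𝔸] in
/-- ★ **THE JUNCTION's `hparC` AT `parA := parKnitY` HOLDS BY PROJECTION** for `C37 := C37KY`. [cite: Balaban1985BackgroundPropagators, (3.19) p.393, (3.35) p.396, bookkeeping] -/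
theorem hparC_of_C37KY :
    ∀ β' (U : CfgY 𝔸 x.toKIdx) (a : AfldY 𝔸 x.toKIdx), C37KY G x ιB R Cq CqK MK aK β₀ β' U a →
      ∀ z w : SiteY x.toKIdx, parKnitY x.toKIdx U z w ∈ G :=
  fun _ _ _ h => h.2.2.1

omit [NormOneClass 𝔸] in
/-- ★ **THE JUNCTION's G-SIDE DICTIONARY `hC37G` HOLDS BY PROJECTION** for `C37 := C37KY`. [cite: Balaban1985BackgroundPropagators, (3.37) p.396, (3.72)–(3.75) p.405, bookkeeping] -/
theorem hC37G_of_C37KY :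
    ∀ β' (U : CfgY 𝔸 x.toKIdx) (a : AfldY 𝔸 x.toKIdx), C37KY G x ιB R Cq CqK MK aK β₀ β' U a → CplxLettersGY G x ιB β' U a :=
  fun _ _ _ h => h.1.2.1

omit [NormOneClass 𝔸] in
/-- ★ **THE JUNCTION's BOND-TRANSPORTER LAW `hvarB` HOLDS BY PROJECTION** for `C37 := C37KY`, `parB := parBY`, `cVar := cVarGY d ℓ`.
[cite: Balaban1985BackgroundPropagators, (3.80)–(3.81) p.406, bookkeeping] -/
theorem hvarB_of_C37KY :
    ∀ β' (U : CfgY 𝔸 x.toKIdx) (a : AfldY 𝔸 x.toKIdx), C37KY G x ιB R Cq CqK MK aK β₀ β' U a →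
      VarParBY x.toKIdx (parBY x.toKIdx) (cVarGY d ℓ) β' U a :=
  fun _ _ _ h => h.1.2.2

omit [NormOneClass 𝔸] in
/-- ★ **THE (3.35) DATUM OF THE BASE** (dag-n06-l's displayed `hC37R`): a class pair has `0 < α₀`, `M_K ≦ M`, `M·α₀ ≦ a_K`, `R α₀ U`.
[cite: Balaban1985BackgroundPropagators, (3.35) p.396, bookkeeping] -/
theorem regDatum_of_C37KY {β' : ℝ} {U : CfgY 𝔸 x.toKIdx} {a : AfldY 𝔸 x.toKIdx} (h : C37KY G x ιB R Cq CqK MK aK β₀ β' U a) :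
    ∃ α₀ : ℝ, 0 < α₀ ∧ MK ≤ (geo9Y x).M ∧ (geo9Y x).M * α₀ ≤ aK ∧ R α₀ U := h.2.2.2.1

omit [NormOneClass 𝔸] in
/-- ★ **THE RAW (3.37) DATUM OF THE FIELD** (the source of dag-n06-l's displayed `hC37A`): `β = L⁴α₁`, `0 < α₁ ≦ 1∕4`, `a ∈ Cplx337` at `α₁`.
[cite: Balaban1985BackgroundPropagators, (3.37) p.396, bookkeeping] -/
theorem cplx337_of_C37KY {β' : ℝ} {U : CfgY 𝔸 x.toKIdx} {a : AfldY 𝔸 x.toKIdx} (h : C37KY G x ιB R Cq CqK MK aK β₀ β' U a) :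
    ∃ α₁ : ℝ, 0 < α₁ ∧ α₁ ≤ 1 / 4 ∧ β' = (((ℓ : ℝ) + 1) ^ 4) * α₁ ∧
      Cplx337 (shiftsV1 (PV d ℓ x.m x.K hd hL)) U (kGeo x.toKIdx).eta (kGeo x.toKIdx).L (levV1 x.toKIdx) α₁ a := h.2.2.2.2.1

omit [NormOneClass 𝔸] in
/-- ★ **THE EXPONENT WINDOW** (dag-n06-l's displayed `hC37β`): a class pair has `0 < β ≦ β₀`. [cite: Balaban1985BackgroundPropagators, (3.37) p.396, bookkeeping] -/
theorem le_of_C37KY {β' : ℝ} {U : CfgY 𝔸 x.toKIdx} {a : AfldY 𝔸 x.toKIdx} (h : C37KY G x ιB R Cq CqK MK aK β₀ β' U a) :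
    0 < β' ∧ β' ≤ β₀ := by
  obtain ⟨α₁, hα₁, -, hβ, -⟩ := h.2.2.2.2.1
  refine ⟨?_, h.2.2.2.2.2⟩
  rw [hβ]
  have hL4 : (1 : ℝ) ≤ ((ℓ : ℝ) + 1) ^ 4 := one_le_pow₀ (by have : (0 : ℝ) ≤ ℓ := Nat.cast_nonneg _; linarith)
  positivity

/-! ## §4 ★★ The class hypothesis `hclass` for the knit class, relative to the two displayed laws -/

/-- ★★ **`hclass` AT ONE MEMBER FOR THE KNIT CLASS**: GIVEN the transporter-variation law `ParVar337Y` and the membership law `ParMemY` at `parKnitY` for a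
regularity predicate `R_K` (constants `C_p`, caps `α_K`, `a_K`), above `2(d+1) < M` and `M_K ≦ M`: every `U′` of the record's class (3.37) at exponent
`0 < α₁ ≦ min(1∕4, α_K)` with `C_p·α₁ ≦ 1∕2` and `L⁴α₁ ≦ β₀`, over a (3.35)-regular base `U` (`0 < α₀`, `M·α₀ ≦ a_K`, `R α₀ U`, `R_K α₀ U`), has the code
`a := A′` (`U′ = e^{iηA′}`) in `C37KY` at exponent `L⁴α₁` with `Cq = 4(d+1)e^{3(d+1)/2}` (straight letters, `hclass_C37GY_at`) and `CqK = 4C_p` (knit letters,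
`cplxLettersY_of_cplx337_par`). [cite: Balaban1985BackgroundPropagators, (3.37) p.396, (3.35) p.396, (3.58) p.402, Thm 3.4 p.400] -/
theorem hclass_C37KY_at (hι : ∀ s : BlkY x.toKIdx, β x.toKIdx.hN x.toKIdx.D x.toKIdx.hk (ιB s) = s)
    (hG1 : ∀ u : 𝔸ˣ, u ∈ G → ‖(u : 𝔸)‖ ≤ 1) (hdM : 2 * ((d : ℝ) + 1) < (geo9Y x).M)
    {RK : ℝ → CfgY 𝔸 x.toKIdx → Prop} {Cp αK : ℝ} (hCp : 0 ≤ Cp)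
    (hlaw : ParVar337Y G x.toKIdx (parKnitY x.toKIdx) RK Cp αK aK) (hmemK : ParMemY G x.toKIdx (parKnitY x.toKIdx) RK aK)
    (hMK : MK ≤ (geo9Y x).M) {c35 α₀ α₁ : ℝ} {U U' : (bg9Y 𝔸 G x).Cfg}
    (hα₀ : 0 < α₀) (haK : (geo9Y x).M * α₀ ≤ aK) (hR : R α₀ U) (hRK : RK α₀ U)
    (hreg : (bg9Y 𝔸 G x).Reg335 c35 α₀ U) (hα₁ : 0 < α₁) (hα₁4 : α₁ ≤ 1 / 4) (hα₁K : α₁ ≤ αK) (hCpα : Cp * α₁ ≤ 1 / 2)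
    (hβ₀ : (((ℓ : ℝ) + 1) ^ 4) * α₁ ≤ β₀) (h37 : (bg9Y 𝔸 G x).Cplx337 α₁ U U') :
    ∃ a : AfldY 𝔸 x.toKIdx, fluct (kGeo x.toKIdx).eta a = U' ∧
      C37KY G x ιB R (4 * ((d : ℝ) + 1) * Real.exp (3 * (((d : ℝ) + 1) / 2))) (4 * Cp) MK aK β₀ ((((ℓ : ℝ) + 1) ^ 4) * α₁) U a := by
  obtain ⟨A', hU', hcl⟩ := h37
  have hU : GVal G x.toKIdx U := hreg.1.1
  have hL4 : (1 : ℝ) ≤ ((ℓ : ℝ) + 1) ^ 4 := one_le_pow₀ (by have : (0 : ℝ) ≤ ℓ := Nat.cast_nonneg _; linarith)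
  have hmono : α₁ ≤ (((ℓ : ℝ) + 1) ^ 4) * α₁ := le_mul_of_one_le_left hα₁.le hL4
  -- the knit table at the corner pairs of `U` is `G`-valued (membership law)
  have hmem : ∀ w : SiteY x.toKIdx, parKnitY x.toKIdx U (blkCornerY x.toKIdx (blkY x.toKIdx w)) w ∈ G :=
    fun w => hmemK α₀ U hα₀ haK hRK _ _
  refine ⟨A', hU'.symm, ?_, ?_, hmemK α₀ U hα₀ haK hRK, ⟨α₀, hα₀, hMK, haK, hR⟩, ⟨α₁, hα₁, hα₁4, rfl, hcl⟩, hβ₀⟩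
  · -- (i) the extended class at `A′` (the body of `hclass_C37GY_at`)
    exact ⟨⟨hU, cplxLettersY_of_cplx337 G x ιB hι hG1 hdM hU hα₁ hα₁4 hcl⟩, cplxLettersGY_of_cplx337 G x ιB hι hG1 hdM hU hα₁.le hcl,
      varParBY_mono x.toKIdx (parBY x.toKIdx) (cVarGY_nonneg d ℓ) hmono (varParBY_parBY_of_cplx337 G x hG1 hU hα₁.le hα₁4 hcl)⟩
  · -- (ii) the knit letters: `cplxLettersY_of_cplx337_par` with the variation law at `U`
    exact cplxLettersY_of_cplx337_par G x (parKnitY x.toKIdx) ιB hι hG1 hdM hU hα₁ hα₁4 hcl (parKnitY_inv x.toKIdx) hmem hCp hCpα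
      (hlaw α₀ U hα₀ haK hRK hU α₁ A' hα₁ hα₁K hcl)

end Class

/-! ## §4b `hclass` for the knit class on a subfamily -/

section Family

variable [NormOneClass 𝔸] {Mstar : ℕ} {J : Type} (f : J → MemberY d ℓ hd hL b₀ b₁ Mstar) (G : Subgroup 𝔸ˣ)
  (ιB : ∀ j : J, BlkY (f j).toKIdx → IBondY (f j).toKIdx) (C38 : ∀ j : J, ℝ → CfgY 𝔸 (f j).toKIdx → AfldY 𝔸 (f j).toKIdx → Prop)
  (R RK : ∀ j : J, ℝ → CfgY 𝔸 (f j).toKIdx → Prop)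

/-- ★ **`hclass` OF THE CODED CARRIER ON A SUBFAMILY, for the codings `codingYx G (f j) (C37KY …) (C38 j)`** — `hclass_C37KY_at` at the members `f j`:
`r := L⁴`, class constants `Cq = 4(d+1)e^{3(d+1)/2}`, `CqK = 4C_p`; thresholds `M_c := max (2(d+1)+1) M_K` on `M` and `a_K` on `M·α₀`; exponent cap
`αcap` with `αcap ≦ 1∕4`, `αcap ≦ α_K`, `C_p·αcap ≦ 1∕2`, `L⁴·αcap ≦ β₀`; the two laws displayed per member, the regularity predicates bridged from the
record's (3.35) (`hR`, `hRK`). [cite: Balaban1985BackgroundPropagators, (3.37) p.396, (3.35) p.396, (3.58) p.402, Thm 3.4 p.400] -/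
theorem hclass_C37KY_on (hι : ∀ (j : J) (s : BlkY (f j).toKIdx), β (f j).toKIdx.hN (f j).toKIdx.D (f j).toKIdx.hk (ιB j s) = s)
    (hG1 : ∀ u : 𝔸ˣ, u ∈ G → ‖(u : 𝔸)‖ ≤ 1) (c35 : ℝ) {Cp αK MK aK β₀ αcap : ℝ} (hCp : 0 ≤ Cp)
    (hlaw : ∀ j, ParVar337Y G (f j).toKIdx (parKnitY (f j).toKIdx) (RK j) Cp αK aK)
    (hmemK : ∀ j, ParMemY G (f j).toKIdx (parKnitY (f j).toKIdx) (RK j) aK)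
    (hR : ∀ j (α₀ : ℝ) (U : CfgY 𝔸 (f j).toKIdx), (bg9Y 𝔸 G (f j)).Reg335 c35 α₀ U → R j α₀ U)
    (hRK : ∀ j (α₀ : ℝ) (U : CfgY 𝔸 (f j).toKIdx), (bg9Y 𝔸 G (f j)).Reg335 c35 α₀ U → RK j α₀ U)
    (hcap4 : αcap ≤ 1 / 4) (hcapK : αcap ≤ αK) (hcapC : Cp * αcap ≤ 1 / 2) (hcapβ : (((ℓ : ℝ) + 1) ^ 4) * αcap ≤ β₀) :
    ∀ (j : J) (α₀ α₁ : ℝ) (U U' : (bg9Y 𝔸 G (f j)).Cfg), max (2 * ((d : ℝ) + 1) + 1) MK ≤ (geo9Y (f j)).M → 0 < α₀ → (geo9Y (f j)).M * α₀ ≤ aK →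
      (bg9Y 𝔸 G (f j)).Reg335 c35 α₀ U → 0 < α₁ → α₁ ≤ αcap → (bg9Y 𝔸 G (f j)).Cplx337 α₁ U U' →
      ∃ a : (codingYx G (f j) (C37KY G (f j) (ιB j) (R j) (4 * ((d : ℝ) + 1) * Real.exp (3 * (((d : ℝ) + 1) / 2))) (4 * Cp) MK aK β₀) (C38 j)).A,
        (codingYx G (f j) (C37KY G (f j) (ιB j) (R j) (4 * ((d : ℝ) + 1) * Real.exp (3 * (((d : ℝ) + 1) / 2))) (4 * Cp) MK aK β₀) (C38 j)).decA a = U' ∧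
        (codingYx G (f j) (C37KY G (f j) (ιB j) (R j) (4 * ((d : ℝ) + 1) * Real.exp (3 * (((d : ℝ) + 1) / 2))) (4 * Cp) MK aK β₀) (C38 j)).C37
          ((((ℓ : ℝ) + 1) ^ 4) * α₁) U a := by
  intro j α₀ α₁ U U' hM hα₀ haK hreg hα₁ hα₁c h37
  have hdM : 2 * ((d : ℝ) + 1) < (geo9Y (f j)).M := by
    have := le_max_left (2 * ((d : ℝ) + 1) + 1) MK; linarith
  have hMK : MK ≤ (geo9Y (f j)).M := (le_max_right _ _).trans hM
  have hL4 : (0 : ℝ) ≤ ((ℓ : ℝ) + 1) ^ 4 := by positivity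
  exact hclass_C37KY_at G (f j) (ιB j) (R j) (hι j) hG1 hdM hCp (hlaw j) (hmemK j) hMK hα₀ haK (hR j α₀ U hreg) (hRK j α₀ U hreg) hreg hα₁
    (hα₁c.trans hcap4) (hα₁c.trans hcapK) ((mul_le_mul_of_nonneg_left hα₁c hCp).trans hcapC)
    ((mul_le_mul_of_nonneg_left hα₁c hL4).trans hcapβ) h37

end Family

end Literature.MathematicalPhysics.QuantumFieldTheory.Balaban1983to89.B9SectBCodedClassKnitY

end
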